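import Summits.ABC.IUTFork.Repair.RH2SigmaHullRow8
import Summits.ABC.IUTFork.Repair.RHQ3LTailSigma8Target
import HarnessLib

/-!
# D-0079 RESCUE sub-cell R-H, ROUND 2 Q3 — the per-curve l-tail TARGET of row 15 «slotreach» (Σ₁₅ ⊋ Σ₈, the family head), typed and PROVED for
# `K/ℚ` Galois by containment from row 8 (seat abc-iut-rh2-q3-typ-1 g2)

Composition (1 claim-tagged target def, proofs by name) of `RHQ3LTailSigma8Target` p479487 (`lTailSigma8_holds`: Q3(row 8) YES per curve on Galois data),
`RHQ3LTailSigma8` p478328 (`inSigma8_of_ltail_of_isGalois`) and abc-iut-rh2-q2-hull's `RH2SigmaHull.exists_certifiedWindow_of_hBand` / `exists_intKummerOrders`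
(p469248/p470562 lineage: `HBand X` ⟹ CERTIFIED slot-reach parameters `(n₀, λ)` and abc-iut-rh-typ-12's `RHSlotReach.SlotReachWindowK` — row 15's datum
predicate of record, ROUND2/START-HERE §0 / `RHInSigmaDatum` docstring — at `e = ramIdx`, `mΘ = j²·m_q`, integer Kummer orders `m_q`). Rung LADDER-ABC:A2.RESCUE.H;
charge director-abc g3 (10) «per kept row as kernel targets». TAKES NO SIDE on [IUTchIII] Cor. 3.12 or on any author; nothing here asserts abc; `SlotReachWindowK`
(abc-iut-rh-typ-12 p457641 / abc-iut-lens-wuc-1) and `HBand`/`InSigma8` are HYPOTHESIS vocabulary consumed BY NAME; «in Σ₁₅» = certified parameters exist for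
which the row-15 window holds as typed, never «S holds».

* `exists_slotReachWindowK_of_inSigma8` — `InSigma8 D` ⟹ ∃ integer Kummer orders `mq` realising `P_q` on the bad places, a certified NON-member profile `n₀`
  ([IUTchIV] Prop. 1.4 (ii)) and a certified MEMBER profile `λ` with `SlotReachWindowK D ramIdx n₀ λ (j²·mq) mq` (q2-hull's two lemmas, rebundled at `D`).
* `exists_slotReachWindowK_of_ltail_of_isGalois` — the same from `K/ℚ` Galois + the per-place tail test (`inSigma8_of_ltail_of_isGalois`).
* TARGET `LTailSigma15 F E` («∃ l₀(E) ∀ l ≥ l₀ ∀ Def. 3.1 data of level l over (F,E) with K/ℚ Galois: such certified parameters with the row-15 window exist»)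
  PROVED (`lTailSigma15_holds`, `l₀` of `lTailSigma8_holds`: `max_{v∣Δmin} p_v^{ord_v(Δ_min)+1}`) ⇒ Q3(row 15) = YES-PER-CURVE (Galois data) through Σ₈ ⊆ Σ₁₅;
  the part of Σ₁₅ ∖ Σ₈ (floor credit) only lowers `l₀`, numerics of record rh2-q3-num / rh2-tab-2 (`l₀¹⁵ ≤ l₀⁸`).
[cite: Mochizuki2012, IUTchI Def. 3.1 (b)(c) pp. 61–62, Ex. 3.2 (iv) p. 71; IUTchIV Prop. 1.2 (i) p. 10, Prop. 1.4 (ii) p. 13] [cite: NeukirchANT1999, Ch. II Prop. (5.5)]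
[cite: SilvermanAEC2009, VII.5 Prop. 5.1(b), VIII.8] [claim: Mochizuki2012, status: disputed] for every IUT locution.
-/

noncomputable section

open Set Function NumberField IsDedekindDomain
open scoped Pointwise

namespace Summit.ABC.IUTFork.Repair.RH.Q3LTailSigma15

open Literature.IUT.LogThetaLattice Literature.IUT.LogVolume Literature.IUT.HodgeTheaters
  Literature.NumberTheory.NumberFields Literature.NumberTheory.GaloisRepresentations.Ultrametric
open Summit.ABC.IUTFork.Thm311 Summit.ABC.IUTFork.Thm311.Real Summit.ABC.IUTFork.Cor312Prov Summit.ABC.IUTFork.Repair.RH2SigmaHull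
  Summit.ABC.IUTFork.Repair.RHSlotReach Summit.ABC.IUTFork.Repair.RH.Q3LTailSigma8

section Genuine

variable {F K Fbar : Type} [Field F] [NumberField F] [Field K] [NumberField K] [Algebra F K] [Field Fbar]
  [Algebra F Fbar] [Algebra K Fbar] {E : WeierstrassCurve F} [E.IsElliptic] {l : ℕ} {Pb : BadPlacePredicates K}
  (D : InitialThetaData F K Fbar E l Pb)

/-- **Σ₈ ⊆ Σ₁₅ AT THE GENUINE DATUM, WITH THE CERTIFICATES.** `InSigma8 D` ⟹ there are integer Kummer orders `mq` realising `P_q` on the bad places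
(`exists_intKummerOrders`), a certified non-member profile `n₀` (`‖u‖ ≤ p^{−(n₀−1)/e}`, `u ∉ log_p 𝒪^×`) and a certified member profile `λ` (`z ∈ log_p 𝒪^×`,
`p^λ ≤ ‖z‖`) — abc-iut-rh2-q2-hull's `exists_certifiedWindow_of_hBand` — with the row-15 window `SlotReachWindowK D ramIdx n₀ λ (j²·mq) mq`.
[cite: Mochizuki2012, IUTchI Ex. 3.2 (iv) p. 71; IUTchIV Prop. 1.4 (ii) p. 13] [claim: Mochizuki2012, status: disputed] -/
theorem exists_slotReachWindowK_of_inSigma8 (h : RH.InSigmaDatum.InSigma8 D) :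
    ∃ (mq : ∀ pp : Nat.Primes, (thetaIndex (pilotDataOfK D K)).Fibre (.inr pp) → ℤ)
      (n₀ : ∀ pp : Nat.Primes, (thetaIndex (pilotDataOfK D K)).Fibre (.inr pp) → ℕ)
      (lam : ∀ pp : Nat.Primes, (thetaIndex (pilotDataOfK D K)).Fibre (.inr pp) → ℝ),
      (∀ (pp : Nat.Primes) (w : (thetaIndex (pilotDataOfK D K)).Fibre (.inr pp)), haveI : Fact (pp : ℕ).Prime := ⟨pp.2⟩;
        placeOf (pilotDataOfK D K) pp.1 w ∈ (pilotDataOfK D K).S →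
          (mq pp w : ℝ) = (pilotDataOfK D K).qPilot (placeOf (pilotDataOfK D K) pp.1 w)) ∧
      (∀ (pp : Nat.Primes) (x : (thetaIndex (pilotDataOfK D K)).Fibre (.inr pp)), haveI : Fact (pp : ℕ).Prime := ⟨pp.2⟩;
        ∃ u : kOf (pilotDataOfK D K) pp.1 x,
          ‖u‖ ≤ (pp : ℝ) ^ (-(((n₀ pp x : ℤ) - 1 : ℤ) : ℝ) / (ramIdx K (placeOf (pilotDataOfK D K) pp.1 x) : ℝ)) ∧
          u ∉ (logUnits (kOf (pilotDataOfK D K) pp.1 x) : Set (kOf (pilotDataOfK D K) pp.1 x))) ∧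
      (∀ (pp : Nat.Primes) (x : (thetaIndex (pilotDataOfK D K)).Fibre (.inr pp)), haveI : Fact (pp : ℕ).Prime := ⟨pp.2⟩;
        ∃ z ∈ (logUnits (kOf (pilotDataOfK D K) pp.1 x) : Set (kOf (pilotDataOfK D K) pp.1 x)), (pp : ℝ) ^ (lam pp x) ≤ ‖z‖) ∧
      SlotReachWindowK D (fun pp x => haveI : Fact (pp : ℕ).Prime := ⟨pp.2⟩; ramIdx K (placeOf (pilotDataOfK D K) pp.1 x)) n₀ lam
        (fun pp i w => ((((i : ℕ) : ℤ) + 1) ^ 2) * mq pp w) mq := by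
  obtain ⟨mq, hmq⟩ := exists_intKummerOrders D
  obtain ⟨n₀, lam, hn₀, hlam, hW⟩ := exists_certifiedWindow_of_hBand (pilotDataOfK D K) mq hmq ((RH.InSigmaDatum.inSigma8_iff D).1 h)
  exact ⟨mq, n₀, lam, hmq, hn₀, hlam, (slotReachWindowK_iff D _ _ _ _ _).2 hW⟩

/-- **ROW 15 IN THE l-TAIL FOR `K/ℚ` GALOIS**: the per-place tail test (`p^t ≤ l`, `ord_v(q_v) + 4e(v|p) ≤ 4e(v|p)·t`) ⟹ certified row-15 parameters
with the window exist (`inSigma8_of_ltail_of_isGalois` ∘ `exists_slotReachWindowK_of_inSigma8`). [claim: Mochizuki2012, status: disputed] -/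
theorem exists_slotReachWindowK_of_ltail_of_isGalois [IsGalois ℚ K]
    (htail : ∀ (pp : Nat.Primes) (w : (thetaIndex (pilotDataOfK D K)).Fibre (.inr pp)),
      haveI : Fact (pp : ℕ).Prime := ⟨pp.2⟩
      placeOf (pilotDataOfK D K) pp.1 w ∈ (pilotDataOfK D K).S →
        ∃ t : ℕ, (pp : ℕ) ^ t ≤ l ∧
          qParamOrd E (finBelow F K (placeOf (pilotDataOfK D K) pp.1 w)) + 4 * ramIdx F (finBelow F K (placeOf (pilotDataOfK D K) pp.1 w)) ≤
            4 * ramIdx F (finBelow F K (placeOf (pilotDataOfK D K) pp.1 w)) * t) :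
    ∃ (mq : ∀ pp : Nat.Primes, (thetaIndex (pilotDataOfK D K)).Fibre (.inr pp) → ℤ)
      (n₀ : ∀ pp : Nat.Primes, (thetaIndex (pilotDataOfK D K)).Fibre (.inr pp) → ℕ)
      (lam : ∀ pp : Nat.Primes, (thetaIndex (pilotDataOfK D K)).Fibre (.inr pp) → ℝ),
      (∀ (pp : Nat.Primes) (w : (thetaIndex (pilotDataOfK D K)).Fibre (.inr pp)), haveI : Fact (pp : ℕ).Prime := ⟨pp.2⟩;
        placeOf (pilotDataOfK D K) pp.1 w ∈ (pilotDataOfK D K).S →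
          (mq pp w : ℝ) = (pilotDataOfK D K).qPilot (placeOf (pilotDataOfK D K) pp.1 w)) ∧
      (∀ (pp : Nat.Primes) (x : (thetaIndex (pilotDataOfK D K)).Fibre (.inr pp)), haveI : Fact (pp : ℕ).Prime := ⟨pp.2⟩;
        ∃ u : kOf (pilotDataOfK D K) pp.1 x,
          ‖u‖ ≤ (pp : ℝ) ^ (-(((n₀ pp x : ℤ) - 1 : ℤ) : ℝ) / (ramIdx K (placeOf (pilotDataOfK D K) pp.1 x) : ℝ)) ∧
          u ∉ (logUnits (kOf (pilotDataOfK D K) pp.1 x) : Set (kOf (pilotDataOfK D K) pp.1 x))) ∧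
      (∀ (pp : Nat.Primes) (x : (thetaIndex (pilotDataOfK D K)).Fibre (.inr pp)), haveI : Fact (pp : ℕ).Prime := ⟨pp.2⟩;
        ∃ z ∈ (logUnits (kOf (pilotDataOfK D K) pp.1 x) : Set (kOf (pilotDataOfK D K) pp.1 x)), (pp : ℝ) ^ (lam pp x) ≤ ‖z‖) ∧
      SlotReachWindowK D (fun pp x => haveI : Fact (pp : ℕ).Prime := ⟨pp.2⟩; ramIdx K (placeOf (pilotDataOfK D K) pp.1 x)) n₀ lam
        (fun pp i w => ((((i : ℕ) : ℤ) + 1) ^ 2) * mq pp w) mq :=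
  exists_slotReachWindowK_of_inSigma8 D (inSigma8_of_ltail_of_isGalois D htail)

end Genuine

section Target

variable (F : Type) [Field F] [NumberField F] (E : WeierstrassCurve F) [E.IsElliptic]

/-- **Q3 TARGET, ROW 15 (per-curve l-tail, Galois data)** [R-H round 2, kernel target]: «∃ l₀(E), ∀ l ≥ l₀, EVERY [IUTchI] Def. 3.1 datum of level `l` over
`(F, E_F)` with `K/ℚ` Galois admits integer Kummer orders realising `P_q`, a certified non-member profile `n₀` and a certified member profile `λ` for which
abc-iut-rh-typ-12's `RHSlotReach.SlotReachWindowK D ramIdx n₀ λ (j²·mq) mq` holds» — the shape consumed by the k2 door of record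
(`RH2SigmaHull.pilotKummerCompatHull_chosen_of_slotReachWindowK`). PROVED below through Σ₈ ⊆ Σ₁₅. [R-H target over a HYPOTHESIS class — not a fact about S]
[cite: Mochizuki2012, IUTchI Def. 3.1 pp. 61–63; IUTchIV Prop. 1.4 (ii) p. 13] [claim: Mochizuki2012, status: disputed] -/
@[claim "Mochizuki2012" "disputed"]
def LTailSigma15 : Prop :=
  ∃ l₀ : ℕ, ∀ l : ℕ, l₀ ≤ l →
    ∀ (K Fbar : Type) [Field K] [NumberField K] [Algebra F K] [Field Fbar] [Algebra F Fbar] [Algebra K Fbar]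
      (Pb : BadPlacePredicates K) (D : InitialThetaData F K Fbar E l Pb), IsGalois ℚ K →
      ∃ (mq : ∀ pp : Nat.Primes, (thetaIndex (pilotDataOfK D K)).Fibre (.inr pp) → ℤ)
        (n₀ : ∀ pp : Nat.Primes, (thetaIndex (pilotDataOfK D K)).Fibre (.inr pp) → ℕ)
        (lam : ∀ pp : Nat.Primes, (thetaIndex (pilotDataOfK D K)).Fibre (.inr pp) → ℝ),
        (∀ (pp : Nat.Primes) (w : (thetaIndex (pilotDataOfK D K)).Fibre (.inr pp)), haveI : Fact (pp : ℕ).Prime := ⟨pp.2⟩;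
          placeOf (pilotDataOfK D K) pp.1 w ∈ (pilotDataOfK D K).S →
            (mq pp w : ℝ) = (pilotDataOfK D K).qPilot (placeOf (pilotDataOfK D K) pp.1 w)) ∧
        (∀ (pp : Nat.Primes) (x : (thetaIndex (pilotDataOfK D K)).Fibre (.inr pp)), haveI : Fact (pp : ℕ).Prime := ⟨pp.2⟩;
          ∃ u : kOf (pilotDataOfK D K) pp.1 x,
            ‖u‖ ≤ (pp : ℝ) ^ (-(((n₀ pp x : ℤ) - 1 : ℤ) : ℝ) / (ramIdx K (placeOf (pilotDataOfK D K) pp.1 x) : ℝ)) ∧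
            u ∉ (logUnits (kOf (pilotDataOfK D K) pp.1 x) : Set (kOf (pilotDataOfK D K) pp.1 x))) ∧
        (∀ (pp : Nat.Primes) (x : (thetaIndex (pilotDataOfK D K)).Fibre (.inr pp)), haveI : Fact (pp : ℕ).Prime := ⟨pp.2⟩;
          ∃ z ∈ (logUnits (kOf (pilotDataOfK D K) pp.1 x) : Set (kOf (pilotDataOfK D K) pp.1 x)), (pp : ℝ) ^ (lam pp x) ≤ ‖z‖) ∧
        SlotReachWindowK D (fun pp x => haveI : Fact (pp : ℕ).Prime := ⟨pp.2⟩; ramIdx K (placeOf (pilotDataOfK D K) pp.1 x)) n₀ lam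
          (fun pp i w => ((((i : ℕ) : ℤ) + 1) ^ 2) * mq pp w) mq

/-- **Q3(row 15) = YES per curve on Galois data**, through Σ₈ ⊆ Σ₁₅: `LTailSigma15 F E` with the `l₀` of `lTailSigma8_holds`
(`max_{v∣Δmin} p_v^{ord_v(Δ_min)+1}`, exponential in the local heights). [cite: SilvermanAEC2009, VII.5 Prop. 5.1(b), VIII.8] [claim: Mochizuki2012, status: disputed] -/
theorem lTailSigma15_holds : LTailSigma15 F E := by
  obtain ⟨l₀, h⟩ := lTailSigma8_holds F E
  exact ⟨l₀, fun l hl K Fbar _ _ _ _ _ _ Pb D hGal => exists_slotReachWindowK_of_inSigma8 D (h l hl K Fbar Pb D hGal)⟩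

/-- `LTailSigma8 ⟹ LTailSigma15` with the SAME `l₀` (row 8 ⊆ row 15 at every datum). [claim: Mochizuki2012, status: disputed] -/
theorem lTailSigma15_of_lTailSigma8 (h : LTailSigma8 F E) : LTailSigma15 F E := by
  obtain ⟨l₀, h⟩ := h
  exact ⟨l₀, fun l hl K Fbar _ _ _ _ _ _ Pb D hGal => exists_slotReachWindowK_of_inSigma8 D (h l hl K Fbar Pb D hGal)⟩

end Target

end Summit.ABC.IUTFork.Repair.RH.Q3LTailSigma15

end
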